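import Literature.MathematicalPhysics.QuantumManyBody.ScatteringLengthDifference
import Literature.MathematicalPhysics.QuantumManyBody.SquareWellScatteringLength
import HarnessLib

/-!
# FGJMOT Lemma 3.3: truncating a repulsive potential at height `K` costs at most `√(2/K)` in the scattering length

Topic `Literature/MathematicalPhysics/QuantumManyBody`, namespace `BoseGas` (provefact
`Literature.MathematicalPhysics.QuantumManyBody.BoseGas.Junge2026_neumannBox_pinnedLowerBound`;
second half of the scattering-length truncation of [FournaisEtAl2024, Prop. 2.1], combining
`ScatteringLengthDifference.lean` (Lemma 3.2) and `SquareWellScatteringLength.lean` ((3.8)–(3.9))).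
[FournaisEtAl2024, Lemma 3.3]: "Given `K > 0` and a non-increasing potential `V`, the potential
`min(V, K)` satisfies `a(V) ≥ a(min(V,K)) ≥ a(V) - 2√2/√K`." Proof as printed: with
`{V > K} = B(0, R_K)`, Lemma 3.2 with `v₁ = V1_B`, `v₂ = K1_B`, `v' = V1_{Bᶜ}` gives
`a(V) - a(min(V,K)) ≤ a(V1_B) - a(K1_B) ≤ R_K - a_K`, and `R_K - a_K = tanh(γ)R_K/γ ≤ √(2/K)`
(`γ = R_K√(K/2)`; the paper bounds this by `2√2/√K`).

Here for BOUNDED measurable radial profiles of finite range (the setting of the tree's zero-energy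
radial ODE, `PeriodicBoseGasScatteringODE*.lean`; the hard-core case is the `N → ∞` limit of the
truncations and is not treated in this file), with the level set given by a radius `R_K`:
`V ≥ K` on `(0, R_K]` and `V ≤ K` beyond `R_K` (nothing is assumed at negative radii, which the
radial theory never sees: `odeScatteringLength_congr_Ioi`).

* `radialIter_congr_Ioi`, …, `odeScatteringLength_congr_Ioi` — the radial ODE data depend only
  on the potential on `(0, ∞)`;
* `FournaisEtAl2024_lemma33` — `a(V) - a(min(V,K)) ≤ √(2/K)` for the ODE scattering lengths read
  off beyond the range, and `FournaisEtAl2024_lemma33_scatteringLength` — the same for the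
  variational scattering lengths (LSSY Thm. C.1); `scatteringLength_min_le` — `a(min(V,K)) ≤ a(V)`.

No definitions.

## References

* [FournaisEtAl2024] S. Fournais, L. Junge, T. Girardot, L. Morin, M. Olivieri, A. Triay, *The free
  energy of dilute Bose gases at low temperatures interacting via strong potentials*,
  arXiv:2408.14222, Ann. Henri Poincaré (2026): Lemma 3.3 and its proof, (3.7)–(3.9).
* [LSSY2005] E. H. Lieb, R. Seiringer, J. P. Solovej, J. Yngvason, *The Mathematics of the Bose Gas
  and its Condensation*, Birkhäuser 2005: App. C, Thm. C.1, Lemma C.2.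
-/

noncomputable section

open MeasureTheory Set Filter Topology
open scoped ENNReal NNReal

namespace Literature.MathematicalPhysics.QuantumManyBody.BoseGas

/-! ### The radial data only see the potential on `(0, ∞)` -/

section Congr

variable {w₁ w₂ : ℝ → ℝ≥0∞}

/-- The Picard iterates agree for potentials agreeing on `(0, ∞)`. [cite: LSSY2005, (2.4)] -/
theorem radialIter_congr_Ioi (h : ∀ s, 0 < s → w₁ s = w₂ s) :
    ∀ (k : ℕ) (r : ℝ), radialIter w₁ k r = radialIter w₂ k r
  | 0, _ => rfl
  | k + 1, r => by
    rw [radialIter_succ, radialIter_succ]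
    congr 1
    refine setLIntegral_congr_fun measurableSet_Ioc fun s hs => ?_
    rw [h s hs.1, radialIter_congr_Ioi h k s]

/-- `u` agrees for potentials agreeing on `(0, ∞)`. [cite: LSSY2005, (2.4)] -/
theorem radialSolE_congr_Ioi (h : ∀ s, 0 < s → w₁ s = w₂ s) (r : ℝ) :
    radialSolE w₁ r = radialSolE w₂ r := by
  simp only [radialSolE, radialIter_congr_Ioi h]

/-- `u` (real) agrees for potentials agreeing on `(0, ∞)`. [cite: LSSY2005, (2.4)] -/
theorem radialSol_congr_Ioi (h : ∀ s, 0 < s → w₁ s = w₂ s) (r : ℝ) :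
    radialSol w₁ r = radialSol w₂ r := by
  simp only [radialSol, radialSolE_congr_Ioi h]

/-- `u'` agrees for potentials agreeing on `(0, ∞)`. [cite: LSSY2005, (2.4)–(2.5)] -/
theorem radialSolDeriv_congr_Ioi (h : ∀ s, 0 < s → w₁ s = w₂ s) (r : ℝ) :
    radialSolDeriv w₁ r = radialSolDeriv w₂ r := by
  simp only [radialSolDeriv]
  congr 2
  refine setLIntegral_congr_fun measurableSet_Ioc fun s hs => ?_
  rw [h s hs.1, radialSolE_congr_Ioi h]

/-- **The ODE scattering length only sees the potential on `(0, ∞)`.** [cite: LSSY2005, (2.5)] -/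
theorem odeScatteringLength_congr_Ioi (h : ∀ s, 0 < s → w₁ s = w₂ s) (R : ℝ) :
    odeScatteringLength w₁ R = odeScatteringLength w₂ R := by
  simp only [odeScatteringLength, radialSol_congr_Ioi h, radialSolDeriv_congr_Ioi h]

end Congr

/-! ### FGJMOT Lemma 3.3 -/

section Lemma33

variable {V : ℝ → ℝ≥0∞} {M R₀ K R : ℝ}

/-- **FGJMOT Lemma 3.3** (bounded measurable radial profile `V ≤ M` of finite range `R₀`; ODE
scattering lengths read off at `R₀`): if `K > 0` and `0 < R_K ≤ R₀` are such that `V ≥ K` on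
`(0, R_K]` and `V ≤ K` beyond `R_K` (e.g. `V` non-increasing with `{V > K} = B(0,R_K)`), then
`a(V) - a(min(V, K)) ≤ √(2/K)`: Lemma 3.2 with `v₁ = V1_{(0,R_K]}`, `v₂ = K1_{(0,R_K]}`,
`v' = V1_{(R_K,∞)}`, then `a(v₁) < R_K` and `a(v₂) = R_K - tanh(R_K√(K/2))/√(K/2)`.
[cite: FournaisEtAl2024, Lemma 3.3] -/
theorem FournaisEtAl2024_lemma33 (hV : Measurable V) (hM : ∀ r, V r ≤ ENNReal.ofReal M) (hM0 : 0 ≤ M)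
    (hR₀ : ∀ s, R₀ < s → V s = 0) (hK : 0 < K) (hR : 0 < R) (hRR₀ : R ≤ R₀)
    (hlow : ∀ r, 0 < r → r ≤ R → ENNReal.ofReal K ≤ V r) (hhigh : ∀ r, R < r → V r ≤ ENNReal.ofReal K) :
    odeScatteringLength V R₀ - odeScatteringLength (fun r => min (V r) (ENNReal.ofReal K)) R₀ ≤
      Real.sqrt (2 / K) := by
  have hR₀pos : 0 < R₀ := hR.trans_le hRR₀
  -- the three potentials of Lemma 3.2
  set v₁ : ℝ → ℝ≥0∞ := (Ioc 0 R).indicator V with hv₁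
  set v₂ : ℝ → ℝ≥0∞ := (Ioc 0 R).indicator fun _ => ENNReal.ofReal K with hv₂
  set v' : ℝ → ℝ≥0∞ := (Ioi R).indicator V with hv'
  set M' : ℝ := max M K with hM'
  have hM'0 : 0 ≤ M' := hM0.trans (le_max_left _ _)
  have hMM' : ENNReal.ofReal M ≤ ENNReal.ofReal M' := ENNReal.ofReal_le_ofReal (le_max_left _ _)
  have hKM' : ENNReal.ofReal K ≤ ENNReal.ofReal M' := ENNReal.ofReal_le_ofReal (le_max_right _ _)
  have hmv₁ : Measurable v₁ := hV.indicator measurableSet_Ioc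
  have hmv₂ : Measurable v₂ := measurable_const.indicator measurableSet_Ioc
  have hmv' : Measurable v' := hV.indicator measurableSet_Ioi
  have hbv₁ : ∀ r, v₁ r ≤ ENNReal.ofReal M' := fun r => by
    rw [hv₁]; by_cases h : r ∈ Ioc 0 R
    · rw [indicator_of_mem h]; exact (hM r).trans hMM'
    · rw [indicator_of_notMem h]; exact zero_le
  have hbv₂ : ∀ r, v₂ r ≤ ENNReal.ofReal M' := fun r => by
    rw [hv₂]; by_cases h : r ∈ Ioc 0 R
    · rw [indicator_of_mem h]; exact hKM'
    · rw [indicator_of_notMem h]; exact zero_le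
  have hbv' : ∀ r, v' r ≤ ENNReal.ofReal M' := fun r => by
    rw [hv']; by_cases h : r ∈ Ioi R
    · rw [indicator_of_mem h]; exact (hM r).trans hMM'
    · rw [indicator_of_notMem h]; exact zero_le
  have h21 : ∀ r, v₂ r ≤ v₁ r := fun r => by
    rw [hv₁, hv₂]; by_cases h : r ∈ Ioc 0 R
    · rw [indicator_of_mem h, indicator_of_mem h]; exact hlow r h.1 h.2
    · rw [indicator_of_notMem h, indicator_of_notMem h]
  have hrv₁ : ∀ s, R₀ < s → v₁ s = 0 := fun s hs =>
    indicator_of_notMem (fun h => absurd h.2 (not_le.2 (hRR₀.trans_lt hs))) _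
  have hrv' : ∀ s, R₀ < s → v' s = 0 := fun s hs => by
    rw [hv']; by_cases h : s ∈ Ioi R
    · rw [indicator_of_mem h]; exact hR₀ s hs
    · exact indicator_of_notMem h _
  -- Lemma 3.2
  have h32 := FournaisEtAl2024_lemma32 hmv₁ hmv₂ hmv' hbv₁ hbv₂ hbv' hM'0 h21 hR₀pos hrv₁ hrv'
  -- identify `v₁ + v'` with `V` and `v₂ + v'` with `min(V, K)` on `(0, ∞)`
  have ha : ∀ s, 0 < s → (v₁ + v') s = V s := fun s hs => by
    simp only [Pi.add_apply, hv₁, hv']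
    rcases le_or_gt s R with h | h
    · have hmem : s ∈ Ioc 0 R := ⟨hs, h⟩
      have hnot : s ∉ Ioi R := not_lt.2 h
      rw [indicator_of_mem hmem, indicator_of_notMem hnot, add_zero]
    · have hnot : s ∉ Ioc 0 R := fun h' => absurd h'.2 (not_le.2 h)
      have hmem : s ∈ Ioi R := h
      rw [indicator_of_notMem hnot, indicator_of_mem hmem, zero_add]
  have hb : ∀ s, 0 < s → (v₂ + v') s = min (V s) (ENNReal.ofReal K) := fun s hs => by
    simp only [Pi.add_apply, hv₂, hv']
    rcases le_or_gt s R with h | h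
    · have hmem : s ∈ Ioc 0 R := ⟨hs, h⟩
      have hnot : s ∉ Ioi R := not_lt.2 h
      rw [indicator_of_mem hmem, indicator_of_notMem hnot, add_zero, min_eq_right (hlow s hs h)]
    · have hnot : s ∉ Ioc 0 R := fun h' => absurd h'.2 (not_le.2 h)
      have hmem : s ∈ Ioi R := h
      rw [indicator_of_notMem hnot, indicator_of_mem hmem, zero_add, min_eq_left (hhigh s h)]
  rw [odeScatteringLength_congr_Ioi ha, odeScatteringLength_congr_Ioi hb] at h32
  refine h32.trans ?_
  -- `a(v₁) < R_K` and `a(v₂) = R_K - tanh/c`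
  have hRv₁ : ∀ s, R < s → v₁ s = 0 := fun s hs =>
    indicator_of_notMem (fun h => absurd h.2 (not_le.2 hs)) _
  have hRv₂ : ∀ s, R < s → v₂ s = 0 := fun s hs =>
    indicator_of_notMem (fun h => absurd h.2 (not_le.2 hs)) _
  have h1 : odeScatteringLength v₁ R₀ < R := by
    rw [odeScatteringLength_eq_of_le_of_le hmv₁ hbv₁ hM'0 hR.le hRv₁ hRR₀]
    exact odeScatteringLength_lt hmv₁ hbv₁ hM'0 hR
  have h2 : odeScatteringLength v₂ R₀ = R - Real.tanh (Real.sqrt (K / 2) * R) / Real.sqrt (K / 2) := by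
    rw [odeScatteringLength_eq_of_le_of_le hmv₂ hbv₂ hM'0 hR.le hRv₂ hRR₀]
    have hwell : ∀ s, 0 < s → v₂ s = (Iic R).indicator (fun _ : ℝ => ENNReal.ofReal K) s := by
      intro s hs
      simp only [hv₂]
      by_cases h : s ≤ R
      · have hmem : s ∈ Ioc 0 R := ⟨hs, h⟩
        have hmem' : s ∈ Iic R := h
        rw [indicator_of_mem hmem, indicator_of_mem hmem']
      · have hnot : s ∉ Ioc 0 R := fun h' => h h'.2
        have hnot' : s ∉ Iic R := h
        rw [indicator_of_notMem hnot, indicator_of_notMem hnot']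
    rw [odeScatteringLength_congr_Ioi hwell, odeScatteringLength_squareWell hK hR.le]
  obtain ⟨_, hle⟩ := sub_scatteringLength_squareWell_le hK hR
  linarith

/-- **FGJMOT Lemma 3.3 for the variational scattering lengths** (LSSY Thm. C.1 identification
for the bounded finite-range potentials `V` and `min(V, K)`):
`a(V) - a(min(V,K)) ≤ √(2/K)`, `a = scatteringLength`. [cite: FournaisEtAl2024, Lemma 3.3]
[cite: LSSY2005, App. C, Thm. C.1] -/
theorem FournaisEtAl2024_lemma33_scatteringLength (hV : Measurable V) (hM : ∀ r, V r ≤ ENNReal.ofReal M)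
    (hM0 : 0 ≤ M) (hR₀ : ∀ s, R₀ < s → V s = 0) (hK : 0 < K) (hR : 0 < R) (hRR₀ : R ≤ R₀)
    (hlow : ∀ r, 0 < r → r ≤ R → ENNReal.ofReal K ≤ V r) (hhigh : ∀ r, R < r → V r ≤ ENNReal.ofReal K) :
    (scatteringLength V).toReal - (scatteringLength fun r => min (V r) (ENNReal.ofReal K)).toReal ≤
      Real.sqrt (2 / K) := by
  have hR₀pos : 0 < R₀ := hR.trans_le hRR₀
  have hmmin : Measurable fun r => min (V r) (ENNReal.ofReal K) := hV.min measurable_const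
  have hbmin : ∀ r, min (V r) (ENNReal.ofReal K) ≤ ENNReal.ofReal M := fun r =>
    (min_le_left _ _).trans (hM r)
  have hrmin : ∀ s, R₀ < s → min (V s) (ENNReal.ofReal K) = 0 := fun s hs => by
    rw [hR₀ s hs]; exact min_eq_left zero_le
  rw [toReal_scatteringLength_eq hV hM hM0 hR₀pos hR₀,
    toReal_scatteringLength_eq hmmin hbmin hM0 hR₀pos hrmin]
  exact FournaisEtAl2024_lemma33 hV hM hM0 hR₀ hK hR hRR₀ hlow hhigh

/-- **`a(min(V,K)) ≤ a(V)`** (monotonicity of the scattering length in the potential).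
[cite: FournaisEtAl2024, Lemma 3.3] -/
theorem scatteringLength_min_le (V : ℝ → ℝ≥0∞) (K : ℝ) :
    scatteringLength (fun r => min (V r) (ENNReal.ofReal K)) ≤ scatteringLength V :=
  scatteringLength_mono fun _ => min_le_left _ _

end Lemma33

end Literature.MathematicalPhysics.QuantumManyBody.BoseGas

end
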